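import Mathlib
import Summits.AtomisticToContinuum.HydrodynamicLimit.Theorems.InformationPercolationEngineKickFairRelEquilibriumMesoTransferAE
import Summits.AtomisticToContinuum.HydrodynamicLimit.Theorems.InformationPercolationEngineKickFairRelEquilibriumMesoPastMeasurable
import Summits.AtomisticToContinuum.HydrodynamicLimit.Theorems.InformationPercolationEngineCollisionRateWindowCountIntegrable
import Summits.AtomisticToContinuum.HydrodynamicLimit.Theorems.InformationPercolationEngineCollisionRateWindowCountMeasurable
import Literature.MathematicalPhysics.KineticTheory.EvenStatTruncationBound
import HarnessLib

/-!
# `KickFairRelEquilibriumMeso`, line `Sketch` — stub O `stub_slotSumIntegrable`: the windowed kick sums are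
# integrable under the invariant law (the plumbing conjunct (o) of the restart stub R″, split off and PROVED)

Prover file (`--supports stmt-AtomisticToContinuum-15177`) of the line lead. The restart-fairness stub R″ of
the skeleton `Cruxes/KickFairRelEquilibriumMeso/Lines/Sketch.lean` asserted three things on every `LG`-typical
level set of the time-zero key: (o) the windowed centred kick sum `Z = slotSum …` is integrable under the
invariant law `G = localGibbsLaw σ 1 0 1 N Φ`, (i) its conditional bias is `o(t_N)`, (ii) it concentrates at
speed `N`. Conjunct (o) is pure plumbing and holds UNCONDITIONALLY (no level set, no profiles): it is proved
here, so that the two remaining restart stubs (`stub_restartBias`, `stub_restartConcentration`, rev 6 of the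
skeleton) carry only the Boltzmann-class content.

Proof: `|Z| ≤ 2C · W` on the good set whenever `|κ_{i,n}| ≤ C` for all `i, n` (`abs_slotSum_le_of_kappa_le`;
the latter holds `G`-a.e., `ae_forall_abs_kappa_le`), `Z` is a.e.-strongly measurable (`aestronglyMeasurable_slotSum`,
from the landed plumbing `stub_pastMeasurable`), and the normalised collision count `W = countFn` is
`G`-integrable: each guarded count `#(collision times of i in (0, τ])` is at most the guarded count over
`[0, |τ| + 1)`, which is integrable under `G` for `σ < σ₀`, `N ≥ 1` by the collision-flux bound of the sibling
line (`CollisionRate.stub_windowCountIntegrableInvariant`: Cercignani–Illner–Pulvirenti 1994 App. 4.A, the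
Boltzmann–Enskog flux onto one sphere under the invariant canonical law).
-/

noncomputable section

open MeasureTheory Set Filter Topology
open scoped ENNReal Classical

namespace Summit.AtomisticToContinuum.HydrodynamicLimit.Theorems.KickFairRelEquilibriumMesoLine

open Literature.Analysis.FluidPDE Literature.MathematicalPhysics.KineticTheory
open Summit.AtomisticToContinuum.HydrodynamicLimit.Theorems

variable {σ : ℝ} {N : ℕ}

/-- On the good set, the count of collision times of `i` in `(0, τ]` is at most the count in `[0, |τ| + 1)`
(the latter set of times is finite on a good orbit). [folklore] -/
theorem cnt_le_ncard_Ico (Φ : Flow σ N) (τ : ℝ) {z : Phase N} (hz : z ∈ Φ.good) (i : Fin (N + 1)) :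
    (cnt Φ τ z i : ℝ) ≤
      ((collisionTimesOf (Torus.geometry (Fin 3)) (hsDiameter σ N) (fun u => Φ.flow u z) i ∩
          Ico 0 (|τ| + 1)).ncard : ℝ) := by
  have hfin : (collisionTimesOf (Torus.geometry (Fin 3)) (hsDiameter σ N) (fun u => Φ.flow u z) i ∩
      Ico 0 (|τ| + 1)).Finite := by
    refine ((Φ.isTrajectory z hz).locFinite 0 (|τ| + 1)).subset ?_
    exact inter_subset_inter (collisionTimesOf_subset _ i) Ico_subset_Icc_self
  have hsub : Ioc (0 : ℝ) τ ⊆ Ico 0 (|τ| + 1) := fun x hx =>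
    ⟨hx.1.le, lt_of_le_of_lt (hx.2.trans (le_abs_self τ)) (lt_add_one _)⟩
  unfold cnt
  exact_mod_cast Set.ncard_le_ncard (inter_subset_inter_right _ hsub) hfin

/-- **The normalised collision count `countFn` is integrable under the invariant law** `G = localGibbsLaw σ 1 0 1 N Φ`,
for `σ` below the small-density threshold of `CollisionRate.stub_windowCountIntegrableInvariant` and `N ≥ 1`. [folklore] -/
theorem exists_integrable_countFn :
    ∃ σ₀ : ℝ, 0 < σ₀ ∧ ∀ σ : ℝ, 0 < σ → σ < σ₀ → ∀ N : ℕ, 1 ≤ N → ∀ Φ : Flow σ N, ∀ τ : ℝ,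
      Integrable (countFn Φ τ) (localGibbsLaw σ (fun _ => 1) (fun _ => 0) (fun _ => 1) N Φ) := by
  obtain ⟨Cf, _, σ₀, hσ₀, hint⟩ := CollisionRate.stub_windowCountIntegrableInvariant
  refine ⟨σ₀, hσ₀, fun σ hσ hσlt N hN Φ τ => ?_⟩
  set G := localGibbsLaw σ (fun _ => (1 : ℝ)) (fun _ => (0 : V3)) (fun _ => (1 : ℝ)) N Φ with hG
  -- the dominating guarded counts over `[0, |τ| + 1)`
  set D : Fin (N + 1) → Phase N → ℝ := fun i z =>
    if z ∈ Φ.good then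
      ((collisionTimesOf (Torus.geometry (Fin 3)) (hsDiameter σ N) (fun u => Φ.flow u z) i ∩
          Ico 0 (|τ| + 1)).ncard : ℝ)
    else 0 with hD
  have hDm : ∀ i, Measurable (D i) := fun i => CollisionRate.measurable_windowCount Φ i 0 (|τ| + 1)
  have hDint : ∀ i, Integrable (D i) G := fun i =>
    (hint σ hσ hσlt N Φ i 0 (|τ| + 1) hN (by positivity) (hDm i)).1
  -- each guarded count is measurable and dominated
  have hgm : ∀ i, Measurable (fun z => (if z ∈ Φ.good then (cnt Φ τ z i : ℝ) else 0)) := by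
    intro i
    have h := measurable_gcnt stub_pastMeasurable hσ Φ τ i
    have : (fun z => (if z ∈ Φ.good then (cnt Φ τ z i : ℝ) else 0)) = fun z => ((gcnt Φ τ z i : ℕ) : ℝ) := by
      funext z; unfold gcnt; split_ifs <;> simp
    rw [this]
    exact (measurable_from_top (f := fun n : ℕ => (n : ℝ))).comp h
  have hgint : ∀ i, Integrable (fun z => (if z ∈ Φ.good then (cnt Φ τ z i : ℝ) else 0)) G := by
    intro i
    refine (hDint i).mono' (hgm i).aestronglyMeasurable (Eventually.of_forall fun z => ?_)
    by_cases hz : z ∈ Φ.good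
    · simp only [hz, if_true, hD, Real.norm_eq_abs, Nat.abs_cast]
      exact cnt_le_ncard_Ico Φ τ hz i
    · simp [hz, hD]
  unfold countFn
  exact (integrable_finsetSum _ fun i _ => hgint i).const_mul _

/-- **Stub O `stub_slotSumIntegrable` (registered, rev 6 of the skeleton): every windowed centred kick sum is
integrable under the invariant law.** There is `σ₀ > 0` such that for `0 < σ < σ₀`, `N ≥ 1`, every flow, horizon,
mesh, window, bounded continuous `g` and measurable weights `|h| ≤ 1`, `slotSum Φ τ r t₁ t₂ g h` is integrable
under `G = localGibbsLaw σ 1 0 1 N Φ`. [folklore] -/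
theorem stub_slotSumIntegrable :
    ∃ σ₀ : ℝ, 0 < σ₀ ∧ ∀ σ : ℝ, 0 < σ → σ < σ₀ → ∀ N : ℕ, 1 ≤ N → ∀ Φ : Flow σ N, ∀ τ r t₁ t₂ : ℝ,
    ∀ g : V3 × V3 × V3 → ℝ, Continuous g → (∃ C : ℝ, ∀ p, |g p| ≤ C) →
    ∀ h : Fin (N + 1) → ℕ → Past N → ℝ, (∀ i n, Measurable (h i n)) → (∀ i n p, |h i n p| ≤ 1) →
    Integrable (slotSum Φ τ r t₁ t₂ g h) (localGibbsLaw σ (fun _ => 1) (fun _ => 0) (fun _ => 1) N Φ) := by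
  obtain ⟨σ₀, hσ₀, hW⟩ := exists_integrable_countFn
  refine ⟨σ₀, hσ₀, fun σ hσ hσlt N hN Φ τ r t₁ t₂ g hg hgb h hh hhb => ?_⟩
  obtain ⟨C, hC⟩ := hgb
  set G := localGibbsLaw σ (fun _ => (1 : ℝ)) (fun _ => (0 : V3)) (fun _ => (1 : ℝ)) N Φ with hG
  have hG0 : G Φ.goodᶜ = 0 := localGibbsLaw_compl_good_eq_zero Φ
  have hae : AEStronglyMeasurable (slotSum Φ τ r t₁ t₂ g h) G :=
    aestronglyMeasurable_slotSum stub_pastMeasurable hσ Φ τ r t₁ t₂ hg hh hG0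
  refine ((hW σ hσ hσlt N hN Φ τ).const_mul (2 * C)).mono' hae ?_
  have hgood : ∀ᵐ z ∂G, z ∈ Φ.good := mem_ae_iff.2 hG0
  filter_upwards [hgood, ae_forall_abs_kappa_le Φ r hC] with z hz hκ
  rw [Real.norm_eq_abs]
  exact abs_slotSum_le_of_kappa_le Φ hσ τ r t₁ t₂ hC hhb hz hκ

end Summit.AtomisticToContinuum.HydrodynamicLimit.Theorems.KickFairRelEquilibriumMesoLine

end
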